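import Mathlib.Combinatorics.SimpleGraph.Walk.Counting
import Mathlib.Combinatorics.SimpleGraph.Paths
import Mathlib.Combinatorics.SimpleGraph.DeleteEdges
import Mathlib.Topology.Algebra.InfiniteSum.ENNReal
import Summits.CriticalPhenomena.SAWScalingLimit.Theorems.SAWTotalPositivityBoundaryTP2Defs
import HarnessLib

/-!
# Crux `BoundaryTP2` (stmt-CriticalPhenomena-7115), line `Sketch`: cut-vertex factorisation of the path kernel

For the fugacity-`x` self-avoiding path kernel `Z_H(a,b) = pathKernel H x a b = Σ_{γ : a → b} x^{|γ|}`
(an `ℝ≥0∞`-valued `tsum` over Mathlib's `SimpleGraph.Path`): if the vertex set is covered by two sets `A`, `B`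
with `A ∩ B = {c}` and every edge of `H` lies inside `A` or inside `B`, then for `a ∈ A`, `b ∈ B`

  `Z_H(a,b) = Z_A(a,c) · Z_B(c,b)`,

where `Z_A` is the kernel of the piece `SimpleGraph.fromRel (fun u v => H.Adj u v ∧ u ∈ A ∧ v ∈ A)` and `Z_B`
likewise (`stub_cutVertex_factor`, a registered stub of the line's skeleton; the equality-case tool of TP₂:
cut vertices, pendant reductions). Proof: a self-avoiding path `a → b` visits the cut vertex `c` (exactly once),
its part before `c` is a path of the `A`-piece and its part after `c` a path of the `B`-piece; conversely two such
paths glue to a self-avoiding path of `H` because their vertex sets meet only in `c`. This gluing is a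
length-additive bijection `(A-piece).Path a c × (B-piece).Path c b ≃ H.Path a b`, and the sum factorises
(`Function.Injective.tsum_eq`, `ENNReal.tsum_prod`, `ENNReal.tsum_mul_left/right`). The degenerate cases
`a = c`, `b = c` are included (the trivial path). Everything proved; Mathlib only. [folklore]
-/

noncomputable section

namespace Summit.CriticalPhenomena.SAWScalingLimit.Theorems.BoundaryTP2

open scoped ENNReal

variable {V : Type*}

/-! ## Walk lemmas -/

/-- Adjacency in the piece of `H` induced on a vertex set `S` (as a graph on all of `V`, built with
`SimpleGraph.fromRel`): `u ∼ v` iff `u ∼_H v` and both lie in `S`. [folklore] -/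
private theorem adj_fromRel_and (H : SimpleGraph V) (S : Set V) (u v : V) :
    (SimpleGraph.fromRel fun u v => H.Adj u v ∧ u ∈ S ∧ v ∈ S).Adj u v ↔ H.Adj u v ∧ u ∈ S ∧ v ∈ S := by
  rw [SimpleGraph.fromRel_adj]
  constructor
  · rintro ⟨-, ⟨h, hu, hv⟩ | ⟨h, hv, hu⟩⟩
    · exact ⟨h, hu, hv⟩
    · exact ⟨h.symm, hu, hv⟩
  · rintro ⟨h, hu, hv⟩
    exact ⟨h.ne, Or.inl ⟨h, hu, hv⟩⟩

/-- In a graph all of whose edges end in `S`, a walk starting in `S` stays in `S`. [folklore] -/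
private theorem support_mem_of_start_mem {G : SimpleGraph V} {S : Set V}
    (hG : ∀ u v, G.Adj u v → v ∈ S) {u v : V} (p : G.Walk u v) (hu : u ∈ S) :
    ∀ w, w ∈ p.support → w ∈ S := by
  induction p with
  | nil =>
    intro w hw
    rw [SimpleGraph.Walk.support_nil, List.mem_singleton] at hw
    subst hw
    exact hu
  | cons h q ih =>
    intro w hw
    rw [SimpleGraph.Walk.support_cons, List.mem_cons] at hw
    rcases hw with rfl | hw
    · exact hu
    · exact ih (hG _ _ h) w hw

/-- **Every walk from `A` to `B` visits the cut vertex.** If `A ∪ B` is everything, `A ∩ B ⊆ {c}` and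
every edge lies inside `A` or inside `B`, a walk from a vertex of `A` to a vertex of `B` visits `c`.
[folklore] -/
private theorem cut_mem_support (H : SimpleGraph V) {A B : Set V} {c b : V}
    (hAB : ∀ v, v ∈ A ∨ v ∈ B) (hc : ∀ v, v ∈ A → v ∈ B → v = c)
    (hsep : ∀ u v, H.Adj u v → (u ∈ A ∧ v ∈ A) ∨ (u ∈ B ∧ v ∈ B)) (hb : b ∈ B) {u : V}
    (p : H.Walk u b) (hu : u ∈ A) : c ∈ p.support := by
  induction p with
  | nil =>
    rw [SimpleGraph.Walk.support_nil, List.mem_singleton]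
    exact (hc _ hu hb).symm
  | @cons u' v' w' h q ih =>
    rw [SimpleGraph.Walk.support_cons, List.mem_cons]
    rcases hAB v' with hv | hv
    · exact Or.inr (ih hb hv)
    · rcases hsep _ _ h with ⟨-, hvA⟩ | ⟨huB, -⟩
      · obtain rfl := hc _ hvA hv
        exact Or.inr q.start_mem_support
      · exact Or.inl (hc _ hu huB).symm

/-- **The part before the cut vertex stays in `A`.** The edges of a self-avoiding path of `H` from a
vertex of `A` to `c` are edges of any graph `G` containing the edges of `H` inside `A` (under the cut
hypotheses: an edge leaving `A` starts at a vertex of `A ∩ B = {c}`, impossible before the end of the path).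
[folklore] -/
private theorem edges_mem_edgeSet_of_isPath (H G : SimpleGraph V) {A B : Set V} {c : V}
    (hG : ∀ u v, H.Adj u v → u ∈ A → v ∈ A → G.Adj u v) (hc : ∀ v, v ∈ A → v ∈ B → v = c)
    (hsep : ∀ u v, H.Adj u v → (u ∈ A ∧ v ∈ A) ∨ (u ∈ B ∧ v ∈ B)) {u : V}
    (p : H.Walk u c) (hp : p.IsPath) (hu : u ∈ A) : ∀ e, e ∈ p.edges → e ∈ G.edgeSet := by
  induction p with
  | nil =>
    intro e he
    simp at he
  | cons h q ih =>
    rw [SimpleGraph.Walk.cons_isPath_iff] at hp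
    intro e he
    rw [SimpleGraph.Walk.edges_cons, List.mem_cons] at he
    rcases hsep _ _ h with ⟨-, hv⟩ | ⟨huB, -⟩
    · rcases he with rfl | he
      · exact (SimpleGraph.mem_edgeSet G).2 (hG _ _ h hu hv)
      · exact ih hc hp.1 hv e he
    · exact absurd (hc _ hu huB) fun huc => hp.2 (by rw [huc]; exact q.end_mem_support)

/-- Left cancellation of `SimpleGraph.Walk.append`. [folklore] -/
private theorem append_cancel_left {G : SimpleGraph V} {u v w : V} {q : G.Walk u v} {r r' : G.Walk v w}
    (h : q.append r = q.append r') : r = r' := by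
  have he := congrArg SimpleGraph.Walk.edges h
  rw [SimpleGraph.Walk.edges_append, SimpleGraph.Walk.edges_append] at he
  exact SimpleGraph.Walk.edges_injective (List.append_cancel_left he)

/-- A self-avoiding path, cut at (the unique occurrence of) its endpoint, is itself. [folklore] -/
private theorem takeUntil_end_of_isPath [DecidableEq V] {G : SimpleGraph V} {u c : V} (q : G.Walk u c)
    (hq : q.IsPath) (h : c ∈ q.support) : q.takeUntil c h = q := by
  have hnil : q.dropUntil c h = SimpleGraph.Walk.nil :=
    (SimpleGraph.Walk.isPath_iff_nil.1 (hq.dropUntil h)).eq_nil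
  calc q.takeUntil c h = (q.takeUntil c h).append (q.dropUntil c h) := by
        rw [hnil, SimpleGraph.Walk.append_nil]
    _ = q := q.take_spec h

/-- Cutting `q ++ r` at the junction `c` returns `q` when `q` is self-avoiding. [folklore] -/
private theorem takeUntil_append_of_isPath [DecidableEq V] {G : SimpleGraph V} {u c w : V}
    (q : G.Walk u c) (hq : q.IsPath) (r : G.Walk c w) (h : c ∈ (q.append r).support) :
    (q.append r).takeUntil c h = q := by
  rw [SimpleGraph.Walk.takeUntil_append_of_mem_left q r q.end_mem_support]
  exact takeUntil_end_of_isPath q hq _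

/-- Unique decomposition at a junction: if `q ++ r = q' ++ r'` with `q`, `q'` self-avoiding paths to the
same vertex, then `q = q'` and `r = r'`. [folklore] -/
private theorem append_inj_of_isPath {G : SimpleGraph V} {u c w : V} {q q' : G.Walk u c}
    {r r' : G.Walk c w} (hq : q.IsPath) (hq' : q'.IsPath) (h : q.append r = q'.append r') :
    q = q' ∧ r = r' := by
  classical
  have hm : c ∈ (q.append r).support :=
    SimpleGraph.Walk.support_subset_support_append_left q r q.end_mem_support
  have key : ∀ (p : G.Walk u w) (hp : c ∈ p.support), p = q'.append r' → p.takeUntil c hp = q' := by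
    rintro p hp rfl
    exact takeUntil_append_of_isPath q' hq' r' hp
  obtain rfl : q = q' := (takeUntil_append_of_isPath q hq r hm).symm.trans (key _ hm h)
  exact ⟨rfl, append_cancel_left h⟩

/-- **Gluing at the cut vertex gives a self-avoiding path.** If `q : a → c` stays in `A`, `r : c → b` stays
in `B`, both are self-avoiding and `A ∩ B ⊆ {c}`, then `q ++ r` is self-avoiding. [folklore] -/
private theorem isPath_append_of_cut {G : SimpleGraph V} {A B : Set V} {a c b : V}
    (hc : ∀ v, v ∈ A → v ∈ B → v = c) (q : G.Walk a c) (r : G.Walk c b) (hq : q.IsPath)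
    (hr : r.IsPath) (hqA : ∀ w, w ∈ q.support → w ∈ A) (hrB : ∀ w, w ∈ r.support → w ∈ B) :
    (q.append r).IsPath := by
  rw [SimpleGraph.Walk.isPath_def, SimpleGraph.Walk.support_append]
  rw [SimpleGraph.Walk.isPath_def] at hq hr
  rw [← SimpleGraph.Walk.cons_tail_support] at hr
  obtain ⟨hcr, hr'⟩ := List.nodup_cons.1 hr
  refine hq.append hr' ?_
  intro w hwq hwr
  have hwB : w ∈ B :=
    hrB w (by rw [← SimpleGraph.Walk.cons_tail_support]; exact List.mem_cons_of_mem _ hwr)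
  obtain rfl := hc w (hqA w hwq) hwB
  exact hcr hwr

/-! ## The factorisation -/

/-- **Cut-vertex factorisation of the self-avoiding path kernel** (registered stub `stub_cutVertex_factor`
of the line `Sketch` of crux `BoundaryTP2`). If the vertex set is covered by `A` and `B` with
`A ∩ B = {c}` and every edge of `H` lies inside `A` or inside `B`, then for `a ∈ A`, `b ∈ B` and `0 ≤ x`,
`Z_H(a,b) = Z_A(a,c) · Z_B(c,b)`, where `Z_A`, `Z_B` are the kernels of the two pieces
`SimpleGraph.fromRel (fun u v => H.Adj u v ∧ u ∈ A ∧ v ∈ A)`, `SimpleGraph.fromRel (fun u v => H.Adj u v ∧ u ∈ B ∧ v ∈ B)`: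
every self-avoiding path `a → b` passes through `c` exactly once, with its part before `c` in `A` and its part
after `c` in `B`, and lengths add. Degenerate cases `a = c`, `b = c` included (`Z(c,c) = 1`). [folklore] -/
theorem stub_cutVertex_factor (H : SimpleGraph V) (x : ℝ) (hx : 0 ≤ x) (A B : Set V) (c a b : V)
    (hAB : ∀ v, v ∈ A ∨ v ∈ B) (hc : ∀ v, v ∈ A → v ∈ B → v = c) (hcA : c ∈ A) (hcB : c ∈ B)
    (hsep : ∀ u v, H.Adj u v → (u ∈ A ∧ v ∈ A) ∨ (u ∈ B ∧ v ∈ B)) (ha : a ∈ A) (hb : b ∈ B) :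
    pathKernel H x a b =
      pathKernel (SimpleGraph.fromRel fun u v => H.Adj u v ∧ u ∈ A ∧ v ∈ A) x a c *
        pathKernel (SimpleGraph.fromRel fun u v => H.Adj u v ∧ u ∈ B ∧ v ∈ B) x c b := by
  classical
  set GA := SimpleGraph.fromRel fun u v => H.Adj u v ∧ u ∈ A ∧ v ∈ A
  set GB := SimpleGraph.fromRel fun u v => H.Adj u v ∧ u ∈ B ∧ v ∈ B
  have hadjA : ∀ u v, GA.Adj u v ↔ H.Adj u v ∧ u ∈ A ∧ v ∈ A := adj_fromRel_and H A
  have hadjB : ∀ u v, GB.Adj u v ↔ H.Adj u v ∧ u ∈ B ∧ v ∈ B := adj_fromRel_and H B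
  have hAle : GA ≤ H := fun u v h => ((hadjA u v).1 h).1
  have hBle : GB ≤ H := fun u v h => ((hadjB u v).1 h).1
  -- edges of walks of the pieces are edges of `H`
  have hAe : ∀ {u v : V} (q : GA.Walk u v), ∀ e, e ∈ q.edges → e ∈ H.edgeSet :=
    fun q e he => SimpleGraph.edgeSet_mono hAle (q.edges_subset_edgeSet he)
  have hBe : ∀ {u v : V} (r : GB.Walk u v), ∀ e, e ∈ r.edges → e ∈ H.edgeSet :=
    fun r e he => SimpleGraph.edgeSet_mono hBle (r.edges_subset_edgeSet he)
  -- walks of the pieces ending / starting at `c` stay in `A` / `B`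
  have hAsupp : ∀ (q : GA.Walk a c), ∀ w, w ∈ q.support → w ∈ A := fun q w hw =>
    support_mem_of_start_mem (fun u v h => ((hadjA u v).1 h).2.2) q.reverse hcA w
      (by rw [SimpleGraph.Walk.support_reverse]; exact List.mem_reverse.2 hw)
  have hBsupp : ∀ (r : GB.Walk c b), ∀ w, w ∈ r.support → w ∈ B := fun r =>
    support_mem_of_start_mem (fun u v h => ((hadjB u v).1 h).2.2) r hcB
  -- the gluing map
  let Φ : GA.Path a c × GB.Path c b → H.Path a b := fun q =>
    ⟨(q.1.1.transfer H (hAe q.1.1)).append (q.2.1.transfer H (hBe q.2.1)),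
      isPath_append_of_cut hc _ _ (q.1.2.transfer _) (q.2.2.transfer _)
        (by rw [SimpleGraph.Walk.support_transfer]; exact hAsupp q.1.1)
        (by rw [SimpleGraph.Walk.support_transfer]; exact hBsupp q.2.1)⟩
  have hΦ : ∀ q, (Φ q).1 = (q.1.1.transfer H (hAe q.1.1)).append (q.2.1.transfer H (hBe q.2.1)) :=
    fun q => rfl
  -- gluing is injective (unique decomposition at the single visit of `c`)
  have hinj : Function.Injective Φ := by
    rintro ⟨⟨α, hα⟩, ⟨β, hβ⟩⟩ ⟨⟨α', hα'⟩, ⟨β', hβ'⟩⟩ h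
    have h1 := congrArg Subtype.val h
    rw [hΦ, hΦ] at h1
    obtain ⟨hq, hr⟩ := append_inj_of_isPath (hα.transfer _) (hα'.transfer _) h1
    have hqe := congrArg SimpleGraph.Walk.edges hq
    have hre := congrArg SimpleGraph.Walk.edges hr
    simp only [SimpleGraph.Walk.edges_transfer] at hqe hre
    obtain rfl := SimpleGraph.Walk.edges_injective hqe
    obtain rfl := SimpleGraph.Walk.edges_injective hre
    rfl
  -- gluing is surjective (cut a path at its visit of `c`)
  have hsurj : ∀ γ : H.Path a b, ∃ q, Φ q = γ := by
    rintro ⟨w, hw⟩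
    have hm : c ∈ w.support := cut_mem_support H hAB hc hsep hb w ha
    have hqe : ∀ e, e ∈ (w.takeUntil c hm).edges → e ∈ GA.edgeSet :=
      edges_mem_edgeSet_of_isPath H GA (fun u v h hu hv => (hadjA u v).2 ⟨h, hu, hv⟩) hc hsep
        (w.takeUntil c hm) (hw.takeUntil hm) ha
    have hre' : ∀ e, e ∈ (w.dropUntil c hm).reverse.edges → e ∈ GB.edgeSet :=
      edges_mem_edgeSet_of_isPath H GB (fun u v h hu hv => (hadjB u v).2 ⟨h, hu, hv⟩)
        (fun v hvB hvA => hc v hvA hvB) (fun u v h => (hsep u v h).symm)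
        (w.dropUntil c hm).reverse (hw.dropUntil hm).reverse hb
    have hre : ∀ e, e ∈ (w.dropUntil c hm).edges → e ∈ GB.edgeSet := fun e he =>
      hre' e (by rw [SimpleGraph.Walk.edges_reverse]; exact List.mem_reverse.2 he)
    refine ⟨(⟨(w.takeUntil c hm).transfer GA hqe, (hw.takeUntil hm).transfer _⟩,
      ⟨(w.dropUntil c hm).transfer GB hre, (hw.dropUntil hm).transfer _⟩), Subtype.ext ?_⟩
    rw [hΦ]
    simp only [SimpleGraph.Walk.transfer_transfer, SimpleGraph.Walk.transfer_self,
      SimpleGraph.Walk.take_spec]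
  -- lengths add under gluing
  have hlen : ∀ q, (Φ q).1.length = q.1.1.length + q.2.1.length := fun q => by
    rw [hΦ, SimpleGraph.Walk.length_append, SimpleGraph.Walk.length_transfer,
      SimpleGraph.Walk.length_transfer]
  calc pathKernel H x a b
      = ∑' q : GA.Path a c × GB.Path c b, ENNReal.ofReal (x ^ (Φ q).1.length) :=
        (hinj.tsum_eq (f := fun γ : H.Path a b => ENNReal.ofReal (x ^ γ.1.length))
          fun γ _ => hsurj γ).symm
    _ = ∑' q : GA.Path a c × GB.Path c b,
          ENNReal.ofReal (x ^ q.1.1.length) * ENNReal.ofReal (x ^ q.2.1.length) := by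
        refine tsum_congr fun q => ?_
        rw [hlen q, pow_add, ENNReal.ofReal_mul (pow_nonneg hx _)]
    _ = ∑' (α : GA.Path a c) (β : GB.Path c b),
          ENNReal.ofReal (x ^ α.1.length) * ENNReal.ofReal (x ^ β.1.length) :=
        ENNReal.tsum_prod (f := fun (α : GA.Path a c) (β : GB.Path c b) =>
          ENNReal.ofReal (x ^ α.1.length) * ENNReal.ofReal (x ^ β.1.length))
    _ = ∑' α : GA.Path a c,
          ENNReal.ofReal (x ^ α.1.length) * ∑' β : GB.Path c b, ENNReal.ofReal (x ^ β.1.length) :=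
        tsum_congr fun _ => ENNReal.tsum_mul_left
    _ = (∑' α : GA.Path a c, ENNReal.ofReal (x ^ α.1.length)) *
          ∑' β : GB.Path c b, ENNReal.ofReal (x ^ β.1.length) := ENNReal.tsum_mul_right
    _ = pathKernel GA x a c * pathKernel GB x c b := rfl

end Summit.CriticalPhenomena.SAWScalingLimit.Theorems.BoundaryTP2
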